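import Summits.HodgeConjecture.HodgeConjecture.Theorems.AnchorTransportVariationalHodgePadicUncountablePropagation
import Literature.AlgebraicGeometry.HodgeTheory.ConjugateFibres
import Literature.AlgebraicGeometry.HodgeTheory.ComplexPointsLifting

/-!
# Route PadicSemiregularLift — support item `HodgeLocusPropagation` (stmt-HodgeConjecture-14977):
# algebraicity at ONE complex point over the generic point gives algebraicity at EVERY such point

HONEST FRAMING: research route conditional on HC_CM; not a corollary; Q11.4-sentence-2 already refuted in dim ≥ 3.
Helper file (nothing here closes an item; no definition, no named fact, no `sorry`; `HC_CM` does
not occur). Cell `pub-hodge-ring2`, binder seat `ring2-b03` (gen 42).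

Setting: `k` a countable algebraically closed field, `σ : k →+* ℂ`, `f₀ : 𝒳₀ ⟶ S₀` over `k` with
`S₀` INTEGRAL and locally of finite type (any dimension, possibly singular), whose complexification
`f = f₀ ⊗_σ ℂ : 𝒳 ⟶ S` is a smooth projective family of relative dimension `n` (smooth, proper,
smooth projective fibres — NO quasi-projectivity of the total space), a global class
`A ∈ H²ᵖ(𝒳(ℂ); ℂ)`, and a complex point `s ∈ S(ℂ)` over the generic point of `S₀` with `A|_{𝒳_s}`
algebraic.

* `mem_algebraicClasses_of_base_pt_eq_genericPoint_of_base_pt_eq_genericPoint` — **`A|_{𝒳_v}` is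
  algebraic at EVERY complex point `v` of `S` over the generic point of `S₀`.** Steps 1–2 are those
  of `everywherePropagation_of_isAlgClosed` (binder seat gen 34, curve bases) and use nothing about
  the dimension of `S₀`: spread the support `V` of `A|_{𝒳_s}` to a closed `Z ⊆ 𝒲₀ = 𝒳₀ ×_{S₀} T₀`
  over a smooth affine integral `T₀` dominating `S₀`, with a complex point `t` of `T = T₀ ⊗ ℂ` over
  the generic point of `T₀`, `h(t) = s`, `𝒲_t ≅ 𝒳_s` carrying the slice `Z_t` onto `V`
  (`exists_spread_isClosed_fiberOver_generic_smooth`); death of `q^* A` off `Z` is constant over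
  the complex points of `T` above a `k`-rational open `O₀ ∋ η_{T₀}`
  (`map_fiberι_mem_ker_restrictCompl_iff_of_baseChangeHom'`); the slice over `t` has codimension
  `≥ p`. Step 3 is new: a complex point `v` over `η_{S₀} = h₀(η_{T₀})` LIFTS to a complex point
  `y` of `T` over `η_{T₀}` with `h(y) = v` (`exists_map_eq_of_base_pt_eq`, Lang II §3); `y` and
  `t` lie over the same point of `T₀`, hence are CONJUGATE under `Aut(ℂ/k)`
  (`exists_conjPoint_eq_of_base_pt_eq`, Lang III §4); the dimension bound on the slice transports
  from `t` to `y` along the scheme isomorphism `𝒲_y ≅ 𝒲_t` over `𝒲₀`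
  (`forall_height_add_le_conjPoint` — only the algebraic subset `Z` is conjugated, never a Betti
  class); death at `y` holds by constancy (`y` is over `O₀`); and death plus codimension on the
  slice over `y` give algebraicity of `A` on `𝒳_{h(y)} = 𝒳_v` (`map_fiberι_mem_algebraicClasses_of_slice`).

References: [VoisinHodgeII2003] §3.3.1; [CharlesSchnell2014Notes] Prop. 11.3.11 (proof),
Lemma 11.3.14; [Lang1958IAG] Ch. II §3, Ch. III §4.
-/

noncomputable section

-- every declaration of this problem lives in `Summit.HodgeConjecture.HodgeConjecture.…` (summit = sub-problem)
set_option linter.dupNamespace false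

open CategoryTheory CategoryTheory.Limits AlgebraicGeometry TopologicalSpace Order Cardinal
open Literature.AlgebraicGeometry.Motives Literature.AlgebraicGeometry.HodgeTheory

namespace Summit.HodgeConjecture.HodgeConjecture.Theorems

/-- **Propagation between the complex points over the generic point — any integral base, no
quasi-projectivity of the total space.** Let `k` be a countable algebraically closed field,
`σ : k →+* ℂ`, `f₀ : 𝒳₀ ⟶ S₀` over `k` with `S₀` integral and locally of finite type, whose
complexification `f : 𝒳 ⟶ S` is a smooth projective family of relative dimension `n`,
`A ∈ H²ᵖ(𝒳(ℂ); ℂ)`, and `s ∈ S(ℂ)` a complex point over the generic point of `S₀` with `A|_{𝒳_s}`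
algebraic. Then `A|_{𝒳_v}` is algebraic for EVERY complex point `v` of `S` over the generic point
of `S₀` (module docstring: spread, death constancy over a `k`-rational open, lifting of `v` to a
complex point of the parameter scheme over its generic point, conjugation of the dimension bound,
algebraicity from death and codimension on the slice). [cite: VoisinHodgeII2003, §3.3.1]
[cite: CharlesSchnell2014Notes, Prop. 11.3.11 (proof) and Lemma 11.3.14]
[cite: Lang1958IAG, Ch. II §3 and Ch. III §4] -/
theorem mem_algebraicClasses_of_base_pt_eq_genericPoint_of_base_pt_eq_genericPoint
    (k : Type) [Field k] [Countable k] [IsAlgClosed k] (σ : k →+* ℂ) ⦃n : ℕ⦄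
    ⦃𝒳₀ S₀ : SchemeOver k⦄ (f₀ : 𝒳₀ ⟶ S₀) [IsIntegral S₀.left] [LocallyOfFiniteType S₀.hom]
    (hf : IsSmoothProjectiveFamily ((baseChangeHom σ).map f₀) n)
    (p : ℕ) (A : complexBetti ((baseChangeHom σ).obj 𝒳₀) (2 * p))
    (s : ComplexPoints ((baseChangeHom σ).obj S₀))
    (hs : (baseChangeHomFst σ S₀).base s.pt = genericPoint S₀.left)
    (hA : complexBetti.map (fiberι ((baseChangeHom σ).map f₀) s) (2 * p) A ∈
      algebraicClasses (fiberOver ((baseChangeHom σ).map f₀) s) p)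
    (v : ComplexPoints ((baseChangeHom σ).obj S₀))
    (hv : (baseChangeHomFst σ S₀).base v.pt = genericPoint S₀.left) :
    complexBetti.map (fiberι ((baseChangeHom σ).map f₀) v) (2 * p) A ∈
      algebraicClasses (fiberOver ((baseChangeHom σ).map f₀) v) p := by
  classical
  letI := σ.toAlgebra
  haveI : CharZero k := σ.charZero
  have hK : #k ≤ ℵ₀ := Cardinal.mk_le_aleph0
  -- ### notation and standing instances
  let 𝒳 : SchemeOver ℂ := (baseChangeHom σ).obj 𝒳₀
  let S : SchemeOver ℂ := (baseChangeHom σ).obj S₀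
  let f : 𝒳 ⟶ S := (baseChangeHom σ).map f₀
  let prS : S.left ⟶ S₀.left := baseChangeHomFst σ S₀
  haveI : IsProper f.left := hf.isProper
  haveI : AlgebraicGeometry.Smooth f.left := hf.smooth
  haveI : IsProper f₀.left := isProper_of_baseChangeHom_map σ f₀
  haveI : AlgebraicGeometry.Smooth f₀.left := smooth_of_baseChangeHom_map σ f₀
  -- ### step 1: the support of `A|_{𝒳_s}` and its spread
  obtain ⟨V, hVc, hVp, hV0⟩ := mem_supportedClasses_iff_exists.1 hA
  have hfs : IsSmoothProjective n (fiberOver f s) := hf.isSmoothProjective s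
  haveI := IsSmoothProjective.isLocallyNoetherian_holds hfs
  haveI := IsSmoothProjective.compactSpace_holds hfs
  haveI : IsNoetherian (fiberOver f s).left := {}
  have hVcpt : IsCompact Vᶜ := NoetherianSpace.isCompact _
  obtain ⟨T₀, 𝒲₀, hT₀aff, hT₀int, hT₀sm, h₀, hlft, hdom, g₀, q₀, Z, t, e, Hsq, hZ, hts, hgen,
    hcomp, hslice⟩ := exists_spread_isClosed_fiberOver_generic_smooth σ f₀ s hs hVc hVcpt
  haveI := hT₀aff
  haveI := hT₀int
  haveI := hlft
  haveI := hdom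
  haveI : AlgebraicGeometry.Smooth T₀.hom := hT₀sm
  -- ### instances for the parameter scheme and the spread family
  let T : SchemeOver ℂ := (baseChangeHom σ).obj T₀
  let 𝒲 : SchemeOver ℂ := (baseChangeHom σ).obj 𝒲₀
  let g : 𝒲 ⟶ T := (baseChangeHom σ).map g₀
  let q : 𝒲 ⟶ 𝒳 := (baseChangeHom σ).map q₀
  let h : T ⟶ S := (baseChangeHom σ).map h₀
  let prT : T.left ⟶ T₀.left := baseChangeHomFst σ T₀
  let prW : 𝒲.left ⟶ 𝒲₀.left := baseChangeHomFst σ 𝒲₀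
  haveI : IrreducibleSpace T.left := irreducibleSpace_baseChangeHom_left σ (X := T₀)
  haveI : AlgebraicGeometry.Smooth T.hom := smooth_baseChangeHom_hom σ (X := T₀)
  obtain ⟨d, hd⟩ := exists_smoothOfRelativeDimension_of_smooth (f := T₀.hom)
  haveI := hd
  haveI : LocallyOfFiniteType T₀.hom := by rw [← Over.w h₀]; infer_instance
  haveI : IsAffineHom T₀.hom := isAffineHom_of_isAffine T₀.hom
  haveI : IsSeparated T₀.hom := inferInstance
  haveI : CompactSpace T₀.left := QuasiCompact.compactSpace_of_compactSpace T₀.hom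
  haveI : IsProper g₀.left := MorphismProperty.of_isPullback (P := @IsProper) Hsq inferInstance
  haveI : AlgebraicGeometry.Smooth g₀.left :=
    MorphismProperty.of_isPullback (P := @AlgebraicGeometry.Smooth) Hsq inferInstance
  have HsqC : IsPullback q g f h := isPullback_baseChangeHom_map_of_isPullback' σ Hsq
  -- ### step 2: death constancy over a `k`-rational open; death and codimension at `t`
  let A' : complexBetti 𝒲 (2 * p) := complexBetti.map q (2 * p) A
  obtain ⟨O₀, hηO₀, hconst⟩ :=
    map_fiberι_mem_ker_restrictCompl_iff_of_baseChangeHom' σ g₀ (d := d) Z hZ (2 * p) A'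
  let Zc : Set 𝒲.left := (prW : 𝒲.left → 𝒲₀.left) ⁻¹' Z
  have hZc : IsClosed Zc := hZ.preimage prW.continuous
  have hslice' : e.hom.left.base ⁻¹' V = (fiberι g t).left.base ⁻¹' Zc := by
    change ⇑e.hom.left ⁻¹' V = ⇑(fiberι g t).left ⁻¹' (⇑prW ⁻¹' Z)
    rw [hslice, Scheme.Hom.comp_base, TopCat.coe_comp, Set.preimage_comp]
  have htO₀ : prT t.pt ∈ O₀ := by
    change baseChangeHomFst σ T₀ t.pt ∈ O₀
    rw [hgen]; exact hηO₀
  have hdeath_t : complexBetti.restrictCompl (fiberOver g t) ((fiberι g t).left.base ⁻¹' Zc) (2 * p)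
      (complexBetti.map (fiberι g t) (2 * p) A') = 0 :=
    restrictCompl_map_fiberι_map_eq_zero_of_fiberIso f q g e hcomp hslice' A hV0
  have hdeathT : ∀ y : ComplexPoints T, prT y.pt ∈ O₀ →
      complexBetti.restrictCompl (fiberOver g y) ((fiberι g y).left.base ⁻¹' Zc) (2 * p)
        (complexBetti.map (fiberι g y) (2 * p) (complexBetti.map q (2 * p) A)) = 0 :=
    fun y hyO => LinearMap.mem_ker.1 ((hconst t y htO₀ hyO).1 (LinearMap.mem_ker.2 hdeath_t))
  have hcodim_t : ∀ z : (fiberOver g t).left, (fiberι g t).left.base z ∈ Zc →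
      height z + p ≤ (n : ℕ∞) :=
    fun z hz => forall_height_add_le_of_fiberIso f g hfs e hslice' hVp z hz
  -- ### step 3: lift `v` to a complex point `y` of `T` over the generic point of `T₀`
  have hη : h₀.left.base (genericPoint T₀.left) = prS.base v.pt := by
    have h1 : prS.base (AlgPoints.map h t).pt = h₀.left.base (prT.base t.pt) := base_pt_map h₀ t
    rw [hts] at h1
    change h₀.left.base (genericPoint T₀.left) = baseChangeHomFst σ S₀ v.pt
    rw [hv, ← hs]
    change baseChangeHomFst σ S₀ s.pt = _ at h1
    rw [h1]
    change h₀.left.base (genericPoint T₀.left) = h₀.left.base (baseChangeHomFst σ T₀ t.pt)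
    rw [hgen]
  obtain ⟨y, hyη, hyv⟩ := exists_map_eq_of_base_pt_eq (σ := σ) h₀ hK hη
  -- `y` and `t` lie over the same point of `T₀`: they are conjugate
  obtain ⟨τ, hτ⟩ := exists_conjPoint_eq_of_base_pt_eq (σ := σ) (S₀ := T₀) hK (s := t) (t := y)
    (by rw [hgen]; exact hyη.symm)
  -- death at `y` by constancy, codimension at `y` by conjugation
  have hyO₀ : prT y.pt ∈ O₀ := by
    change baseChangeHomFst σ T₀ y.pt ∈ O₀
    rw [hyη]; exact hηO₀
  have hdeath_y := hdeathT y hyO₀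
  have hcodim_y : ∀ z : (fiberOver g y).left, (fiberι g y).left.base z ∈ Zc →
      height z + p ≤ (n : ℕ∞) := by
    rw [← hτ]
    exact forall_height_add_le_conjPoint σ g₀ τ t Z p n hcodim_t
  -- ### conclusion on `𝒳_{h y} = 𝒳_v`
  have hmem := map_fiberι_mem_algebraicClasses_of_slice f h q g HsqC y
    (hf.isSmoothProjective _) hZc A hdeath_y hcodim_y
  rw [hyv] at hmem
  exact hmem

end Summit.HodgeConjecture.HodgeConjecture.Theorems

end
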